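/-
Copyright (c) 2026 The HodgeConjecture formalisation campaign. All rights reserved.
Released under Apache 2.0 license as described in the file LICENSE.
-/
import Summits.HodgeConjecture.HodgeConjecture.Theorems.K2E1ChiIntertwiningScalarEulerQuotientU2   -- ★ p861632 (K2E1-p13): `c_ε^S(z) = L^S(2z−1,ε)∕L^S(2z,ε)`, `exists_differentiableOn_sub_one_mul_chiScalar`
import Summits.HodgeConjecture.HodgeConjecture.Theorems.K2E1ChiScatteringPackageUniqueU2         -- ★ ONE-SOURCE uniqueness (`eqOn_of_eqOn_tube`); brings ★ `countable_of_codiscrete`, ★ `isPreconnected_convex_diff_of_countable`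
import HarnessLib

/-!
# THE CONTINUED SCATTERING COEFFICIENT OF THE `χ`-EISENSTEIN SERIES OF `U(J₂)` IS THE EULER QUOTIENT `A(z)·L^S(2z−1, χ₀)∕L^S(2z, χ₀)` ON `Re z > ½` — ONE-SOURCE TRANSFER FROM
# THE TUBE (Rogawski 1990, §13.9; Mœglin–Waldspurger 1995, IV.1.10–IV.1.11)

Cell `pub/hodgecm-mathlib`, R90-TF section S8 «ContSpec-n½» (R90-CS-plan (g0) deal J2 (b) 16:11:02Z, ROAD `R90/S8/ROAD-S8B2.K2E1-p13-g3.md` R2-χ∕R4-χ, p13's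
`CENSUS-R2chi-local` (J2) «by the uniqueness route», p15's J1 census (β)).  THEOREMS ONLY (no `def`, no `instance`, no notation, no named-fact hypothesis, no `sorry`); lane
`--supports stmt-HodgeConjecture-24833 --as helper` (count-neutral, closes no socket).

THE POINT.  A continued scattering package of the E1 `χ`-road (★ (α)∕G3∕`chi_scattering_…` byte shapes) carries, for each coordinate, a tube value `q(z)` (`1 < Re z`), a continuation
`qc` analytic off a closed co-discrete `P`, and `qc = q` on the tube.  If a SECOND SOURCE identifies the tube value as
`q(z) = A(z) · L^S(2z−1, ε)∕L^S(2z, ε)` (`ε = χ₀ = χ|_{𝔸_F^×}`, `A` = the finitely many bad-place, archimedean and Haar-normalisation factors, holomorphic on `Re z > ½`) — this is the ONE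
LETTER `hsrc`, where K2Liu's ★ rank-one Siegel package (`a^S∕b^S`, `s = z − ½`) through the ★ adelic bridge `K2E1BorelIntertwiningU2FromK2Liu` and the J1a dictionary (K2E1-p15) enter,
openly, to be discharged by the junction file J2′ — then, because `(z−1)·L^S(2z−1,ε)∕L^S(2z,ε)` is the restriction of a function `G` HOLOMORPHIC on `Re z > ½` with `G(1) ≠ 0 ⟺ ε = 1`
(★ p861632 §4), the identity theorem on the preconnected `{½ < Re} ∖ P` transfers the factorisation to the whole half-plane: **`(z−1)·qc(z) = A(z)·G(z)` off `P` on `Re z > ½`**.  Hence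
(§3) `qc` has NO singularity on `{½ < Re} ∖ {1}`, none at `1` either when `ε ≠ 1`, and `(z−1)qc(z) → A(1)G(1)` at `1` — the R4-χ input of the S8B#4 assembly («a pole of the scattering
coefficient on `Re z > ½` forces `χ₀ = 1` and sits at `z = 1`», [Rogawski1990, §13.9 case (i)] at `N = 2`), in the `hcres` letter shape of the ★ R5 package.

CONTENTS:
* §1 (generic complex analysis) `eventually_nhds_not_mem_of_codiscrete`, **`eqOn_halfPlane_of_eqOn_tube`** — `f` analytic off co-discrete `P`, `A, G` holomorphic on `{½ < Re}`,
  `(z−1)f = A·G` on the tube off `P` ⟹ on `{½ < Re}` off `P`.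
* §2 **`exists_sub_one_mul_qc_eq_of_oneSource`** (MAIN, hypothesis-first over the package clauses `hqcq hPcd hqa`, p861632's `hε hA1 hS hur`, and the one letter `hsrc` with `(A, hA)`):
  `∃ G, DifferentiableOn ℂ G {½ < re} ∧ (G 1 ≠ 0 ↔ ε = 1) ∧ ∀ z ∉ P, ½ < z.re → (z − 1)·qc z = A z·G z`.
* §3 `exists_analyticAt_eventuallyEq_qc_of_ne` (removable off `1`), `exists_analyticAt_eventuallyEq_qc_of_ne_one` (`ε ≠ 1`: removable at `1` too),
  `tendsto_sub_one_mul_qc` (`(z−1)qc z → A 1 · G 1` along `𝓝[≠] 1`).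
* §4 CM print `exists_sub_one_mul_qc_eq_of_oneSource_cm` (`F = L⁺`).

HONEST LABEL: HC_CM is proved only modulo the 7 printed citations (2 remaining named inputs: hLiu418 = `stmt-HodgeConjecture-24832`, h413 =
`stmt-HodgeConjecture-24833`) until rung 0 closes; REL ≠ ★ ≠ BUILT; count-neutral helper; the letter `hsrc` is NOT discharged here.
-/

-- (for Claude) Library norms: see HarnessLib/Guide.lean. Problem-specific definitions are under review —
-- flag anything that looks too strong or too weak.

set_option autoImplicit false
set_option linter.style.longLine false
set_option linter.dupNamespace false

noncomputable section

open scoped NNReal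
open Set Filter Topology Complex NumberField IsDedekindDomain
open Literature.NumberTheory.Automorphic Literature.NumberTheory.LFunctions Literature.NumberTheory.GaloisRepresentations
open Summit.HodgeConjecture.HodgeConjecture.Cruxes.H413.K2E1ConvexDiffCountableConnected (countable_of_codiscrete isPreconnected_convex_diff_of_countable)
open Summit.HodgeConjecture.HodgeConjecture.Cruxes.H413.K2E1ChiIntertwiningScalarEulerQuotientU2 (exists_differentiableOn_sub_one_mul_chiScalar)

namespace Summit.HodgeConjecture.HodgeConjecture.Cruxes.H413.K2E1ChiScatteringEulerQuotientU2

/-! ## §1 Identity transfer from the tube to the half-plane `{½ < Re}` off a co-discrete set -/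

section Generic

/-- A point off a co-discrete set has a whole neighbourhood off it. [folklore] -/
theorem eventually_nhds_not_mem_of_codiscrete {P : Set ℂ} (hPcd : ∀ z₀ : ℂ, ∀ᶠ s in 𝓝[≠] z₀, s ∉ P) {z₀ : ℂ} (hz₀ : z₀ ∉ P) :
    ∀ᶠ s in 𝓝 z₀, s ∉ P := by
  filter_upwards [eventually_nhdsWithin_iff.1 (hPcd z₀)] with s hs
  by_cases h : s = z₀
  · rwa [h]
  · exact hs h

/-- **IDENTITY TRANSFER ON THE HALF-PLANE**: `f` analytic off a co-discrete `P`; `A`, `G` holomorphic on `{½ < Re}`; `(z−1)·f z = A z·G z` at every tube point `1 < Re z` off `P` ⟹ the same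
at every point of `{½ < Re}` off `P` (the open set `{½ < Re} ∖ P` is preconnected — a convex open set minus a countable set, ★ `isPreconnected_convex_diff_of_countable` — and contains a
tube point by density). [cite: MoeglinWaldspurger1995, IV.1.10] [cite: BernsteinLapid2019, Thm 2.3] -/
theorem eqOn_halfPlane_of_eqOn_tube {f A G : ℂ → ℂ} {P : Set ℂ} (hPcd : ∀ z₀ : ℂ, ∀ᶠ s in 𝓝[≠] z₀, s ∉ P)
    (hf : ∀ z : ℂ, z ∉ P → AnalyticAt ℂ f z) (hA : DifferentiableOn ℂ A {z : ℂ | 1 / 2 < z.re}) (hG : DifferentiableOn ℂ G {z : ℂ | 1 / 2 < z.re})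
    (htube : ∀ z : ℂ, z ∉ P → 1 < z.re → (z - 1) * f z = A z * G z) :
    ∀ z : ℂ, z ∉ P → 1 / 2 < z.re → (z - 1) * f z = A z * G z := by
  intro z hz hzre
  have hopen : IsOpen {w : ℂ | 1 / 2 < w.re} := isOpen_lt continuous_const Complex.continuous_re
  have hcount : P.Countable := countable_of_codiscrete hPcd
  have hpre : IsPreconnected ({w : ℂ | 1 / 2 < w.re} \ P) :=
    isPreconnected_convex_diff_of_countable Literature.Topology.Euclidean.one_lt_rank_real_complex (convex_halfSpace_re_gt (1 / 2)) hopen hcount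
  have hfA : AnalyticOnNhd ℂ (fun w => (w - 1) * f w) ({w : ℂ | 1 / 2 < w.re} \ P) := fun w hw =>
    ((analyticAt_id.sub analyticAt_const).mul (hf w hw.2))
  have hgA : AnalyticOnNhd ℂ (fun w => A w * G w) ({w : ℂ | 1 / 2 < w.re} \ P) := fun w hw =>
    (hA.analyticAt (hopen.mem_nhds hw.1)).mul (hG.analyticAt (hopen.mem_nhds hw.1))
  -- a tube point off `P`
  have htopen : IsOpen {w : ℂ | 1 < w.re} := isOpen_lt continuous_const Complex.continuous_re
  obtain ⟨z₁, hz₁t, hz₁P⟩ := (hcount.dense_compl ℂ).inter_open_nonempty _ htopen ⟨2, by simp⟩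
  have hz₁t' : 1 < z₁.re := hz₁t
  have hev : (fun w => (w - 1) * f w) =ᶠ[𝓝 z₁] fun w => A w * G w := by
    filter_upwards [htopen.mem_nhds hz₁t, eventually_nhds_not_mem_of_codiscrete hPcd hz₁P] with w hw hwP using htube w hwP hw
  have h1 : z₁ ∈ {w : ℂ | 1 / 2 < w.re} \ P := ⟨show 1 / 2 < z₁.re by linarith, hz₁P⟩
  exact hfA.eqOn_of_preconnected_of_eventuallyEq hgA hpre h1 hev ⟨hzre, hz⟩

end Generic

/-! ## §2 The one-source transfer for the `χ`-scattering coefficient of `U(J₂)` -/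

section Scattering

variable {F : Type} [Field F] [NumberField F] {ε : HeckeCharacter F} {S : Set (HeightOneSpectrum (𝓞 F))}

-- the statement carries the E1 package clauses and p861632's character hypotheses; ≈ 1 kB of binders
/-- **`(z−1)·qc(z) = A(z)·G(z)` ON `{½ < Re}` OFF `P` — THE CONTINUED `χ`-SCATTERING COEFFICIENT IS THE EULER QUOTIENT.**  DATA (hypothesis-first): a unitary Hecke character `ε` of `F`
trivial on the diagonal positive reals and unramified off the finite `S` (p861632's `hε hA1 hS hur`; read `ε = χ₀`); ONE coordinate of a continued scattering package — tube value `q`,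
continuation `qc` analytic off the co-discrete `P`, `qc = q` on the tube (★ clause shapes `hqcq hPcd hqa`); and THE LETTER `hsrc`: on the tube `q(z) = A(z)·L^S(2z−1,ε)∕L^S(2z,ε)` with `A`
holomorphic on `{½ < Re}` (second source: K2Liu's ★ rank-one package + ★ adelic bridge + J1a dictionary, discharged elsewhere).  CONCLUSION: with the ★ continuation `G` of
`(z−1)·L^S(2z−1,ε)∕L^S(2z,ε)` (holomorphic on `{½ < Re}`, `G(1) ≠ 0 ⟺ ε = 1`), `(z−1)·qc z = A z·G z` for every `z ∉ P` with `½ < Re z`.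
[cite: Rogawski1990, §13.9 p. 229] [cite: MoeglinWaldspurger1995, IV.1.10–IV.1.11] [cite: Langlands1976, Appendix] -/
theorem exists_sub_one_mul_qc_eq_of_oneSource (hε : ε.IsUnitary) (hA1 : ∀ t : ℝ≥0ˣ, ε (posRealIdele F t) = 1) (hS : S.Finite) (hur : ∀ v ∉ S, ε.IsUnramifiedAt v)
    (q qc : ℂ → ℂ) {P : Set ℂ} (hqcq : ∀ z : ℂ, 1 < z.re → qc z = q z) (hPcd : ∀ z₀ : ℂ, ∀ᶠ s in 𝓝[≠] z₀, s ∉ P) (hqa : ∀ z : ℂ, z ∉ P → AnalyticAt ℂ qc z)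
    (A : ℂ → ℂ) (hA : DifferentiableOn ℂ A {z : ℂ | 1 / 2 < z.re})
    (hsrc : ∀ z : ℂ, 1 < z.re →
      q z = A z * (partialStandardL S (fun v => {ε.valueAtUniformizer v}) (2 * z - 1) / partialStandardL S (fun v => {ε.valueAtUniformizer v}) (2 * z))) :
    ∃ G : ℂ → ℂ, DifferentiableOn ℂ G {z : ℂ | 1 / 2 < z.re} ∧ (G 1 ≠ 0 ↔ ε = 1) ∧
      ∀ z : ℂ, z ∉ P → 1 / 2 < z.re → (z - 1) * qc z = A z * G z := by
  obtain ⟨G, hG, hGeq, hG1⟩ := exists_differentiableOn_sub_one_mul_chiScalar (S := S) hε hA1 hS hur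
  refine ⟨G, hG, hG1, eqOn_halfPlane_of_eqOn_tube hPcd hqa hA hG fun z _ hz => ?_⟩
  rw [hqcq z hz, hsrc z hz, ← hGeq z hz]
  ring

/-! ## §3 Consequences: no singularity off `1`, none at `1` when `ε ≠ 1`, and the residue letter at `1` -/

/-- **NO SINGULARITY OF `qc` ON `{½ < Re} ∖ {1}`**: at every `z₀ ≠ 1` with `½ < Re z₀` the coefficient `qc` agrees on a punctured neighbourhood with a function analytic at `z₀`
(namely `A·G∕(z−1)`), whether or not `z₀ ∈ P`. [cite: Rogawski1990, §13.9 p. 229] [cite: MoeglinWaldspurger1995, IV.1.11] -/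
theorem exists_analyticAt_eventuallyEq_qc_of_ne (hε : ε.IsUnitary) (hA1 : ∀ t : ℝ≥0ˣ, ε (posRealIdele F t) = 1) (hS : S.Finite) (hur : ∀ v ∉ S, ε.IsUnramifiedAt v)
    (q qc : ℂ → ℂ) {P : Set ℂ} (hqcq : ∀ z : ℂ, 1 < z.re → qc z = q z) (hPcd : ∀ z₀ : ℂ, ∀ᶠ s in 𝓝[≠] z₀, s ∉ P) (hqa : ∀ z : ℂ, z ∉ P → AnalyticAt ℂ qc z)
    (A : ℂ → ℂ) (hA : DifferentiableOn ℂ A {z : ℂ | 1 / 2 < z.re})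
    (hsrc : ∀ z : ℂ, 1 < z.re →
      q z = A z * (partialStandardL S (fun v => {ε.valueAtUniformizer v}) (2 * z - 1) / partialStandardL S (fun v => {ε.valueAtUniformizer v}) (2 * z)))
    {z₀ : ℂ} (hz₀ : 1 / 2 < z₀.re) (hz₁ : z₀ ≠ 1) :
    ∃ g : ℂ → ℂ, AnalyticAt ℂ g z₀ ∧ qc =ᶠ[𝓝[≠] z₀] g := by
  obtain ⟨G, hG, -, hmain⟩ := exists_sub_one_mul_qc_eq_of_oneSource hε hA1 hS hur q qc hqcq hPcd hqa A hA hsrc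
  have hopen : IsOpen {w : ℂ | 1 / 2 < w.re} := isOpen_lt continuous_const Complex.continuous_re
  refine ⟨fun z => A z * G z / (z - 1), ((hA.analyticAt (hopen.mem_nhds hz₀)).mul (hG.analyticAt (hopen.mem_nhds hz₀))).div
    (analyticAt_id.sub analyticAt_const) (sub_ne_zero.2 hz₁), ?_⟩
  have h1 : ∀ᶠ s in 𝓝 z₀, s ≠ 1 := isOpen_ne.mem_nhds hz₁
  filter_upwards [hPcd z₀, mem_nhdsWithin_of_mem_nhds (hopen.mem_nhds hz₀), mem_nhdsWithin_of_mem_nhds h1] with s hsP hs hs1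
  rw [eq_div_iff (sub_ne_zero.2 hs1), mul_comm, hmain s hsP hs]

/-- **`ε ≠ 1`: NO SINGULARITY OF `qc` ANYWHERE ON `{½ < Re}`** — at `z₀ = 1` too, since then `G(1) = 0` and `G(z) = (z−1)·G₁(z)` with `G₁ = dslope G 1` analytic at `1`, so `qc = A·G₁` on a
punctured neighbourhood of `1`. («For `χ₀ ≠ 1` the `χ`-Eisenstein series of `U(1,1)` contributes nothing to the residual spectrum.») [cite: Rogawski1990, §13.9 p. 229]
[cite: MoeglinWaldspurger1995, IV.1.11] -/
theorem exists_analyticAt_eventuallyEq_qc_of_ne_one (hε : ε.IsUnitary) (hA1 : ∀ t : ℝ≥0ˣ, ε (posRealIdele F t) = 1) (h1 : ε ≠ 1) (hS : S.Finite)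
    (hur : ∀ v ∉ S, ε.IsUnramifiedAt v)
    (q qc : ℂ → ℂ) {P : Set ℂ} (hqcq : ∀ z : ℂ, 1 < z.re → qc z = q z) (hPcd : ∀ z₀ : ℂ, ∀ᶠ s in 𝓝[≠] z₀, s ∉ P) (hqa : ∀ z : ℂ, z ∉ P → AnalyticAt ℂ qc z)
    (A : ℂ → ℂ) (hA : DifferentiableOn ℂ A {z : ℂ | 1 / 2 < z.re})
    (hsrc : ∀ z : ℂ, 1 < z.re →
      q z = A z * (partialStandardL S (fun v => {ε.valueAtUniformizer v}) (2 * z - 1) / partialStandardL S (fun v => {ε.valueAtUniformizer v}) (2 * z)))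
    {z₀ : ℂ} (hz₀ : 1 / 2 < z₀.re) :
    ∃ g : ℂ → ℂ, AnalyticAt ℂ g z₀ ∧ qc =ᶠ[𝓝[≠] z₀] g := by
  by_cases hz₁ : z₀ ≠ 1
  · exact exists_analyticAt_eventuallyEq_qc_of_ne hε hA1 hS hur q qc hqcq hPcd hqa A hA hsrc hz₀ hz₁
  rw [ne_eq, not_not] at hz₁
  subst hz₁
  obtain ⟨G, hG, hG1, hmain⟩ := exists_sub_one_mul_qc_eq_of_oneSource hε hA1 hS hur q qc hqcq hPcd hqa A hA hsrc
  have hG0 : G 1 = 0 := by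
    by_contra h
    exact h1 (hG1.1 h)
  have hopen : IsOpen {w : ℂ | 1 / 2 < w.re} := isOpen_lt continuous_const Complex.continuous_re
  have hGa : AnalyticAt ℂ G 1 := hG.analyticAt (hopen.mem_nhds hz₀)
  obtain ⟨p, hp⟩ := hGa
  have hds : AnalyticAt ℂ (dslope G 1) 1 := ⟨_, hp.has_fpower_series_dslope_fslope⟩
  refine ⟨fun z => A z * dslope G 1 z, (hA.analyticAt (hopen.mem_nhds hz₀)).mul hds, ?_⟩
  filter_upwards [hPcd 1, mem_nhdsWithin_of_mem_nhds (hopen.mem_nhds hz₀), self_mem_nhdsWithin] with s hsP hs hs1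
  have hs1' : s - 1 ≠ 0 := sub_ne_zero.2 hs1
  have hslope : (s - 1) * dslope G 1 s = G s := by
    have h := sub_smul_dslope G 1 s
    rwa [smul_eq_mul, hG0, sub_zero] at h
  have h := hmain s hsP hs
  rw [← hslope, ← mul_assoc, mul_comm (A s), mul_assoc] at h
  exact mul_left_cancel₀ hs1' h

/-- **THE RESIDUE LETTER AT `z = 1`**: `(z−1)·qc(z) → A(1)·G(1)` along `𝓝[≠] 1` (the `hcres` shape of the ★ R5 continued-Eisenstein package, with `r := A 1 * G 1`; by ★ p861632 §4 the
limit is non-zero iff `ε = 1 ∧ A 1 ≠ 0`). [cite: MoeglinWaldspurger1995, IV.1.11] [cite: Langlands1976, §7] -/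
theorem tendsto_sub_one_mul_qc (hε : ε.IsUnitary) (hA1 : ∀ t : ℝ≥0ˣ, ε (posRealIdele F t) = 1) (hS : S.Finite) (hur : ∀ v ∉ S, ε.IsUnramifiedAt v)
    (q qc : ℂ → ℂ) {P : Set ℂ} (hqcq : ∀ z : ℂ, 1 < z.re → qc z = q z) (hPcd : ∀ z₀ : ℂ, ∀ᶠ s in 𝓝[≠] z₀, s ∉ P) (hqa : ∀ z : ℂ, z ∉ P → AnalyticAt ℂ qc z)
    (A : ℂ → ℂ) (hA : DifferentiableOn ℂ A {z : ℂ | 1 / 2 < z.re})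
    (hsrc : ∀ z : ℂ, 1 < z.re →
      q z = A z * (partialStandardL S (fun v => {ε.valueAtUniformizer v}) (2 * z - 1) / partialStandardL S (fun v => {ε.valueAtUniformizer v}) (2 * z))) :
    ∃ G : ℂ → ℂ, DifferentiableOn ℂ G {z : ℂ | 1 / 2 < z.re} ∧ (G 1 ≠ 0 ↔ ε = 1) ∧
      Tendsto (fun z : ℂ => (z - 1) * qc z) (𝓝[≠] 1) (𝓝 (A 1 * G 1)) := by
  obtain ⟨G, hG, hG1, hmain⟩ := exists_sub_one_mul_qc_eq_of_oneSource hε hA1 hS hur q qc hqcq hPcd hqa A hA hsrc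
  refine ⟨G, hG, hG1, ?_⟩
  have hopen : IsOpen {w : ℂ | 1 / 2 < w.re} := isOpen_lt continuous_const Complex.continuous_re
  have h1 : (1 : ℂ) ∈ {w : ℂ | 1 / 2 < w.re} := by
    show (1 : ℝ) / 2 < (1 : ℂ).re
    norm_num
  have hcont : ContinuousAt (fun z => A z * G z) 1 :=
    ((hA.differentiableAt (hopen.mem_nhds h1)).continuousAt).mul ((hG.differentiableAt (hopen.mem_nhds h1)).continuousAt)
  have hev : (fun z : ℂ => (z - 1) * qc z) =ᶠ[𝓝[≠] 1] fun z => A z * G z := by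
    filter_upwards [hPcd 1, mem_nhdsWithin_of_mem_nhds (hopen.mem_nhds h1)] with s hsP hs using hmain s hsP hs
  exact (tendsto_nhdsWithin_of_tendsto_nhds hcont.tendsto).congr' hev.symm

end Scattering

/-! ## §4 The CM print `F = L⁺` -/

section CM

variable (L : Type) [Field L] [NumberField L]

/-- **THE CM PRINT (`U(1,1)_{L∕L⁺}`)**: for the restriction `ε = χ₀` to `𝔸_{L⁺}^×` of the cuspidal datum `χ` of the Borel of `U(Φ₂)` (unitary, trivial on `ℝ_{>0}`, unramified off the
finite `S`) and one coordinate `(q, qc, P)` of a continued `χ`-scattering package with the one-source tube factorisation `q = A·L^S(2z−1,ε)∕L^S(2z,ε)`: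
`(z−1)·qc z = A z·G z` off `P` on `{½ < Re}`, `G` holomorphic there, `G 1 ≠ 0 ⟺ ε = 1`. [cite: Rogawski1990, §13.9 p. 229] [cite: MoeglinWaldspurger1995, IV.1.11] -/
theorem exists_sub_one_mul_qc_eq_of_oneSource_cm {ε : HeckeCharacter ↥(maximalRealSubfield L)} {S : Set (HeightOneSpectrum (𝓞 ↥(maximalRealSubfield L)))}
    (hε : ε.IsUnitary) (hA1 : ∀ t : ℝ≥0ˣ, ε (posRealIdele ↥(maximalRealSubfield L) t) = 1) (hS : S.Finite) (hur : ∀ v ∉ S, ε.IsUnramifiedAt v)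
    (q qc : ℂ → ℂ) {P : Set ℂ} (hqcq : ∀ z : ℂ, 1 < z.re → qc z = q z) (hPcd : ∀ z₀ : ℂ, ∀ᶠ s in 𝓝[≠] z₀, s ∉ P) (hqa : ∀ z : ℂ, z ∉ P → AnalyticAt ℂ qc z)
    (A : ℂ → ℂ) (hA : DifferentiableOn ℂ A {z : ℂ | 1 / 2 < z.re})
    (hsrc : ∀ z : ℂ, 1 < z.re →
      q z = A z * (partialStandardL S (fun v => {ε.valueAtUniformizer v}) (2 * z - 1) / partialStandardL S (fun v => {ε.valueAtUniformizer v}) (2 * z))) :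
    ∃ G : ℂ → ℂ, DifferentiableOn ℂ G {z : ℂ | 1 / 2 < z.re} ∧ (G 1 ≠ 0 ↔ ε = 1) ∧
      ∀ z : ℂ, z ∉ P → 1 / 2 < z.re → (z - 1) * qc z = A z * G z :=
  exists_sub_one_mul_qc_eq_of_oneSource hε hA1 hS hur q qc hqcq hPcd hqa A hA hsrc

end CM

end Summit.HodgeConjecture.HodgeConjecture.Cruxes.H413.K2E1ChiScatteringEulerQuotientU2

end
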